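import Summits.Ventures.DiscreteObjects.Hadamard.ElemAbelianRegular
import Summits.Ventures.DiscreteObjects.Hadamard.ElemAbelianCycleBound
import Summits.Ventures.DiscreteObjects.Hadamard.PrimeOrder7FixedRows668

/-!
# Hadamard 668 census, family F12 — no `C₇ × C₇` of signed automorphisms of an H(668) (kernel)

Framing: lottery ticket; floor = certified bounds/negative ranges.

Cell pub-namedobj (venture DiscreteObjects), target (H), hadamard gen 17.  **`no_hadamard668_elemAbelian_rank2_7`**: a
Hadamard matrix of order `668` admits no two signed-permutation automorphisms `(α, α', d₁, e₁)`, `(β, β', d₂,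
    e₂)` with
`α⁷ = β⁷ = α'⁷ = β'⁷ = 1`, commuting permutation parts, and `α, β` independent (`α^a β^b = 1`, `a,
    b < 7` ⇒ `a = b = 0`).
With gen 16 (`p ≥ 11`): **no `C_p × C_p` of signed automorphisms of an H(668) for every prime `p ≥ 7`.**
(FAMILY-F12-G16 had `C₇ × C₇` excluded only at the 'summed orbit level' by two scripts; this file makes it kernel.  An
exact enumeration (gen 17, code/rank2_p7_weak2.py) showed that the WEAK forms of the orbit identities already kill all
1928 orbit-structure pairs, so no orbit-structure bookkeeping is needed.)
PROOF.  Every `g ≠ 1` fixes `f(g) ∈ {24, 38, 52, 66, 80}` rows and as many admissible columns (`census7`: window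
`84 ≤ m ≤ 94`, `m` even, of `hadamard668_signedAut_colClasses_window`,
    and `m ≠ 94` by `hadamard668_fixedRows_7_ne_10`).
`R` = the 8 standard line representatives; `D` / `D'` = rows / columns fixed by `α, β` / `α', β'` (= by everything).
(1) FREE ROW (`rank2_exists_free`): the rows fixed by some `g ≠ 1` number at most `Σ_{r ∈ R} f(r) ≤ 8·80 = 640 < 668`,
so some row has trivial stabiliser; `rank2_regular_bound` gives `49·|D'| ≤ 668`, and `|D'| ≡ f ≡ 3 (mod 7)`
(`rank2_card_fixed_mod`), so `|D'| ∈ {3, 10}` (`rank2_7_fixedAll`); on the transpose, `|D| ∈ {3, 10}`.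
(2) BURNSIDE on the rows through the line partition (`sum_erase_one_eq_lines`, `sq_dvd_sum_card_fixed_pair`):
`49 ∣ 668 + 6·Σ_r f_R(r)`; if every representative fixed only `D` this is `49 ∣ 668 + 48·|D|`, false for
`|D| ∈ {3, 10}`; so some `rK ∈ R` fixes a row `x₀ ∉ D`, moved by `α` or by `β` (`rank2_7_exists_moved`).
(3) CYCLE BOUND (`rank2_cycle_bound`): `7·|T| ≤ 668` for `T = ⋃_{r ≠ rK} Fix_cols(r)`, while
`|T| = |D'| + Σ_{r ≠ rK} (f(r) − |D'|) ≥ 3 + 7·14 = 101` (`rank2_card_biUnion_fixed`; `f(r) ≥ 24 > |D'| + 7`):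
`707 > 668`.  Ours, not literature; no `sorry`; default heartbeats (the argument is split into lemmas).
-/

namespace Summit.Ventures.DiscreteObjects.Hadamard

open Finset BigOperators Matrix

open Literature.Combinatorics.Designs.GoethalsSeidel (IsHadamardMatrix)

variable {ι : Type*} [Fintype ι] [DecidableEq ι]

/-- the census for order 7 at the matrix level: `24, 38, 52, 66` or `80` fixed columns, and the same list for rows -/
lemma census7 {H : Matrix ι ι ℤ} (hH : IsHadamardMatrix H) (hι : Fintype.card ι = 668)
    {π κ : Equiv.Perm ι} {d e : ι → ℤ} (haut : IsSignedAut H π κ d e) (hπ : π ^ 7 = 1) (hκ : κ ^ 7 = 1)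
    (hne : π ≠ 1) :
    ((univ.filter fun j => κ j = j).card = 24 ∨ (univ.filter fun j => κ j = j).card = 38 ∨
      (univ.filter fun j => κ j = j).card = 52 ∨ (univ.filter fun j => κ j = j).card = 66 ∨
      (univ.filter fun j => κ j = j).card = 80) ∧
    ((univ.filter fun i => π i = i).card = 24 ∨ (univ.filter fun i => π i = i).card = 38 ∨
      (univ.filter fun i => π i = i).card = 52 ∨ (univ.filter fun i => π i = i).card = 66 ∨
      (univ.filter fun i => π i = i).card = 80) := by
  have hp : (7 : ℕ).Prime := by norm_num
  have hmem : (7 : ℕ) = 3 ∨ (7 : ℕ) = 5 ∨ (7 : ℕ) = 7 ∨ (7 : ℕ) = 11 := Or.inr (Or.inr (Or.inl rfl))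
  obtain ⟨⟨a, ha⟩, -, -, wc, -⟩ := hadamard668_signedAut_colClasses_window hH hι hmem π κ d e haut hπ hκ (Or.inl hne)
  obtain ⟨⟨b, hb⟩, -, -, wr, -⟩ := hadamard668_signedAut_rowClasses_window hH hι hmem π κ d e haut hπ hκ (Or.inl hne)
  have hc1 := card_fixed_add_classes κ hp hκ; have hr1 := card_fixed_add_classes π hp hπ
  rw [hι] at hc1 hr1
  have wc' := wc rfl; have wr' := wr rfl
  obtain ⟨h10c, h10r⟩ := hadamard668_fixedRows_7_ne_10 hH hι π κ d e haut hπ hκ (Or.inl hne)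
  constructor <;> omega

section generic
variable (p : ℕ) [hp : Fact p.Prime] (α β : Equiv.Perm ι)

omit [Fintype ι] [DecidableEq ι] in
/-- the first generator as a pair permutation -/
lemma pairPerm_genA : (α ^ (Multiplicative.toAdd (Multiplicative.ofAdd ((1 : ZMod p), (0 : ZMod p)))).1.val
    * β ^ (Multiplicative.toAdd (Multiplicative.ofAdd ((1 : ZMod p), (0 : ZMod p)))).2.val) = α := by
  haveI : Fact (1 < p) := ⟨hp.out.one_lt⟩
  simp only [toAdd_ofAdd, ZMod.val_one, ZMod.val_zero, pow_one, pow_zero, mul_one]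

omit [Fintype ι] [DecidableEq ι] in
/-- the second generator as a pair permutation -/
lemma pairPerm_genB : (α ^ (Multiplicative.toAdd (Multiplicative.ofAdd ((0 : ZMod p), (1 : ZMod p)))).1.val
    * β ^ (Multiplicative.toAdd (Multiplicative.ofAdd ((0 : ZMod p), (1 : ZMod p)))).2.val) = β := by
  haveI : Fact (1 < p) := ⟨hp.out.one_lt⟩
  simp only [toAdd_ofAdd, ZMod.val_one, ZMod.val_zero, pow_one, pow_zero, one_mul]

omit [Fintype ι] [DecidableEq ι] in
/-- the two generators are distinct standard representatives, off each other's lines -/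
lemma gens_reps :
    (Multiplicative.ofAdd ((1 : ZMod p), (0 : ZMod p))) ∈ (insert (Multiplicative.ofAdd ((0 : ZMod p), (1 : ZMod p)))
        ((univ : Finset (ZMod p)).image (fun t => Multiplicative.ofAdd ((1 : ZMod p), t))))
            ∧ (Multiplicative.ofAdd ((0 : ZMod p), (1 : ZMod p))) ∈ (insert (Multiplicative.ofAdd ((0 : ZMod p),
            (1 : ZMod p)))
        ((univ : Finset (ZMod p)).image (fun t => Multiplicative.ofAdd ((1 : ZMod p), t))))
            ∧ (Multiplicative.ofAdd ((1 : ZMod p), (0 : ZMod p))) ≠ (Multiplicative.ofAdd ((0 : ZMod p),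
            (1 : ZMod p))) ∧ (Multiplicative.ofAdd ((1 : ZMod p), (0 : ZMod p))) ≠ 1
            ∧ (Multiplicative.ofAdd ((0 : ZMod p), (1 : ZMod p))) ≠ 1 ∧
    (Multiplicative.ofAdd ((0 : ZMod p),
        (1 : ZMod p))) ∉ (Finset.range (p - 1)).image (fun k => (Multiplicative.ofAdd ((1 : ZMod p),
        (0 : ZMod p))) ^ (k + 1)) := by
  haveI : Fact (1 < p) := ⟨hp.out.one_lt⟩
  have hg : (Multiplicative.ofAdd ((1 : ZMod p), (0 : ZMod p))) ∈ (insert (Multiplicative.ofAdd ((0 : ZMod p),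
      (1 : ZMod p)))
        ((univ : Finset (ZMod p)).image (fun t => Multiplicative.ofAdd ((1 : ZMod p),
            t)))) := Finset.mem_insert_of_mem (Finset.mem_image.mpr ⟨0, Finset.mem_univ _, rfl⟩)
  have hh : (Multiplicative.ofAdd ((0 : ZMod p), (1 : ZMod p))) ∈ (insert (Multiplicative.ofAdd ((0 : ZMod p),
      (1 : ZMod p)))
        ((univ : Finset (ZMod p)).image (fun t => Multiplicative.ofAdd ((1 : ZMod p),
            t)))) := Finset.mem_insert_self _ _
  have hne : (Multiplicative.ofAdd ((1 : ZMod p), (0 : ZMod p))) ≠ (Multiplicative.ofAdd ((0 : ZMod p),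
      (1 : ZMod p))) := by
    intro h01
    have := congrArg (fun x => (Multiplicative.toAdd x).1) h01
    simp at this
  exact ⟨hg, hh, hne, lineRep_ne_one p hg, lineRep_ne_one p hh, rep_not_mem_pline_rep p hg hh hne⟩

/-- **a free point**: if every representative fixes at most `N` points and `(p+1)·N < n`, some point is moved by every
`g ≠ 1` (it lies outside the union of the fixed sets of the representatives). -/
lemma rank2_exists_free (hα : α ^ p = 1) (hβ : β ^ p = 1) (hc : Commute α β) (N : ℕ)
    (hN : ∀ r ∈ (insert (Multiplicative.ofAdd ((0 : ZMod p), (1 : ZMod p)))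
        ((univ : Finset (ZMod p)).image (fun t => Multiplicative.ofAdd ((1 : ZMod p), t)))),
            (univ.filter fun x => (α ^ (Multiplicative.toAdd r).1.val
            * β ^ (Multiplicative.toAdd r).2.val) x = x).card ≤ N) (hlt : (p + 1) * N < Fintype.card ι) :
    ∃ x₁ : ι, ∀ g : Multiplicative (ZMod p × ZMod p), (α ^ (Multiplicative.toAdd g).1.val
        * β ^ (Multiplicative.toAdd g).2.val) x₁ = x₁ → g = 1 := by
  classical
  have hex : ∃ x₁ : ι, ∀ r ∈ (insert (Multiplicative.ofAdd ((0 : ZMod p), (1 : ZMod p)))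
        ((univ : Finset (ZMod p)).image (fun t => Multiplicative.ofAdd ((1 : ZMod p), t)))),
            (α ^ (Multiplicative.toAdd r).1.val * β ^ (Multiplicative.toAdd r).2.val) x₁ ≠ x₁ := by
    by_contra hno
    have hall : ∀ x : ι, ∃ r ∈ (insert (Multiplicative.ofAdd ((0 : ZMod p), (1 : ZMod p)))
        ((univ : Finset (ZMod p)).image (fun t => Multiplicative.ofAdd ((1 : ZMod p), t)))),
            (α ^ (Multiplicative.toAdd r).1.val * β ^ (Multiplicative.toAdd r).2.val) x = x := by
      intro x
      by_contra hx
      exact hno ⟨x, fun r hr hrx => hx ⟨r, hr, hrx⟩⟩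
    have hsub : (univ : Finset ι) ⊆ (insert (Multiplicative.ofAdd ((0 : ZMod p), (1 : ZMod p)))
        ((univ : Finset (ZMod p)).image (fun t => Multiplicative.ofAdd ((1 : ZMod p),
            t)))).biUnion (fun r => univ.filter fun x => (α ^ (Multiplicative.toAdd r).1.val
            * β ^ (Multiplicative.toAdd r).2.val) x = x) := by
      intro x _
      obtain ⟨r, hr, hx⟩ := hall x
      rw [Finset.mem_biUnion]
      exact ⟨r, hr, Finset.mem_filter.mpr ⟨Finset.mem_univ x, hx⟩⟩
    have h1 := Finset.card_le_card hsub
    have h2 := Finset.card_biUnion_le (s := (insert (Multiplicative.ofAdd ((0 : ZMod p), (1 : ZMod p)))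
        ((univ : Finset (ZMod p)).image (fun t => Multiplicative.ofAdd ((1 : ZMod p),
            t))))) (t := fun r => univ.filter fun x => (α ^ (Multiplicative.toAdd r).1.val
            * β ^ (Multiplicative.toAdd r).2.val) x = x)
    have h3 : ∑ r ∈ (insert (Multiplicative.ofAdd ((0 : ZMod p), (1 : ZMod p)))
        ((univ : Finset (ZMod p)).image (fun t => Multiplicative.ofAdd ((1 : ZMod p), t)))),
            (univ.filter fun x => (α ^ (Multiplicative.toAdd r).1.val
            * β ^ (Multiplicative.toAdd r).2.val) x = x).card ≤ ∑ _r ∈ (insert (Multiplicative.ofAdd ((0 : ZMod p),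
            (1 : ZMod p)))
        ((univ : Finset (ZMod p)).image (fun t => Multiplicative.ofAdd ((1 : ZMod p), t)))), N :=
      Finset.sum_le_sum hN
    rw [Finset.sum_const, smul_eq_mul, card_lineReps p] at h3
    rw [Finset.card_univ] at h1
    omega
  obtain ⟨x₁, hx₁⟩ := hex
  refine ⟨x₁, fun g hgx => ?_⟩
  by_contra hg
  obtain ⟨r, hr, hgr⟩ := exists_rep_mem_pline p g hg
  rw [mem_pline_iff] at hgr
  obtain ⟨k, hk, rfl⟩ := hgr
  rw [pairPerm_pow p α β hα hβ hc] at hgx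
  exact hx₁ r hr (fixed_of_pow_fixed p _ (pairPerm_pow_p p α β hα hβ hc r) (by omega) (by omega) hgx)

/-- `rank2_card_fixed_mod` for the two generators: `|D| ≤ #Fix(r)` and `#Fix(r) ≡ |D| (mod p)` with
`D = {x : α x = x ∧ β x = x}` -/
lemma rank2_card_fixed_mod_gen (hα : α ^ p = 1) (hβ : β ^ p = 1) (hc : Commute α β)
    {r : Multiplicative (ZMod p × ZMod p)} (hr : r ∈ (insert (Multiplicative.ofAdd ((0 : ZMod p), (1 : ZMod p)))
        ((univ : Finset (ZMod p)).image (fun t => Multiplicative.ofAdd ((1 : ZMod p), t))))) :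
    (univ.filter fun x => α x = x ∧ β x = x).card ≤ (univ.filter fun x => (α ^ (Multiplicative.toAdd r).1.val
        * β ^ (Multiplicative.toAdd r).2.val) x = x).card ∧
    (univ.filter fun x => (α ^ (Multiplicative.toAdd r).1.val
        * β ^ (Multiplicative.toAdd r).2.val) x = x).card % p = (univ.filter fun x => α x = x
        ∧ β x = x).card % p := by
  obtain ⟨-, -, -, hg1, hh1, hgh⟩ := gens_reps p
  have h := rank2_card_fixed_mod p α β hα hβ hc hg1 hh1 hgh hr
  simpa only [pairPerm_genA, pairPerm_genB] using h

/-- `rank2_card_biUnion_fixed` for the two generators -/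
lemma rank2_card_biUnion_fixed_gen (hα : α ^ p = 1) (hβ : β ^ p = 1) (hc : Commute α β)
    {rK : Multiplicative (ZMod p × ZMod p)} (hrK : rK ∈ (insert (Multiplicative.ofAdd ((0 : ZMod p), (1 : ZMod p)))
        ((univ : Finset (ZMod p)).image (fun t => Multiplicative.ofAdd ((1 : ZMod p), t))))) :
    (((insert (Multiplicative.ofAdd ((0 : ZMod p), (1 : ZMod p)))
        ((univ : Finset (ZMod p)).image (fun t => Multiplicative.ofAdd ((1 : ZMod p),
            t)))).erase rK).biUnion (fun r => univ.filter fun x => (α ^ (Multiplicative.toAdd r).1.val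
            * β ^ (Multiplicative.toAdd r).2.val) x = x)).card =
      (univ.filter fun x => α x = x ∧ β x = x).card +
      ∑ r ∈ (insert (Multiplicative.ofAdd ((0 : ZMod p), (1 : ZMod p)))
        ((univ : Finset (ZMod p)).image (fun t => Multiplicative.ofAdd ((1 : ZMod p), t)))).erase rK,
            ((univ.filter fun x => (α ^ (Multiplicative.toAdd r).1.val
            * β ^ (Multiplicative.toAdd r).2.val) x = x).card - (univ.filter fun x => α x = x ∧ β x = x).card) := by
  obtain ⟨-, -, -, hg1, hh1, hgh⟩ := gens_reps p
  have h := rank2_card_biUnion_fixed p α β hα hβ hc hg1 hh1 hgh hrK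
  simpa only [pairPerm_genA, pairPerm_genB] using h

end generic

omit [Fintype ι] [DecidableEq ι] in
/-- a lower bound for a sum of differences -/
lemma card_mul_le_sum_sub {X : Type*} (s : Finset X) (f : X → ℕ) (c m : ℕ) (h : ∀ r ∈ s, m + c ≤ f r) :
    s.card * m ≤ ∑ r ∈ s, (f r - c) := by
  rw [← smul_eq_mul, ← Finset.sum_const]
  exact Finset.sum_le_sum (fun r hr => by have := h r hr; omega)

section seven
variable {H : Matrix ι ι ℤ} {α α' β β' : Equiv.Perm ι} {d₁ e₁ d₂ e₂ : ι → ℤ}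

/-- **(1) the columns fixed by everything**: `49·|D'| ≤ 668` and `|D'| ≡ 3 (mod 7)`, given that the ROW parts of all
`g ≠ 1` are nontrivial -/
lemma rank2_7_fixedAll (hH : IsHadamardMatrix H) (hι : Fintype.card ι = 668)
    (hA : IsSignedAut H α α' d₁ e₁) (hB : IsSignedAut H β β' d₂ e₂)
    (hα : α ^ 7 = 1) (hα' : α' ^ 7 = 1) (hβ : β ^ 7 = 1) (hβ' : β' ^ 7 = 1)
    (hc : Commute α β) (hc' : Commute α' β')
    (hne : ∀ g : Multiplicative (ZMod 7 × ZMod 7), g ≠ 1 → (α ^ (Multiplicative.toAdd g).1.val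
        * β ^ (Multiplicative.toAdd g).2.val) ≠ 1) :
    7 ^ 2 * (univ.filter fun y => α' y = y ∧ β' y = y).card ≤ 668 ∧
      (univ.filter fun y => α' y = y ∧ β' y = y).card % 7 = 3 := by
  haveI hp7 : Fact (Nat.Prime 7) := ⟨by norm_num⟩
  have hodd : Odd 7 := by decide
  have hcensus : ∀ g : Multiplicative (ZMod 7 × ZMod 7), g ≠ 1 →
      ((univ.filter fun j => (α' ^ (Multiplicative.toAdd g).1.val
          * β' ^ (Multiplicative.toAdd g).2.val) j = j).card = 24
          ∨ (univ.filter fun j => (α' ^ (Multiplicative.toAdd g).1.val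
          * β' ^ (Multiplicative.toAdd g).2.val) j = j).card = 38
          ∨ (univ.filter fun j => (α' ^ (Multiplicative.toAdd g).1.val
          * β' ^ (Multiplicative.toAdd g).2.val) j = j).card = 52
          ∨ (univ.filter fun j => (α' ^ (Multiplicative.toAdd g).1.val
          * β' ^ (Multiplicative.toAdd g).2.val) j = j).card = 66
          ∨ (univ.filter fun j => (α' ^ (Multiplicative.toAdd g).1.val
          * β' ^ (Multiplicative.toAdd g).2.val) j = j).card = 80) ∧
      ((univ.filter fun i => (α ^ (Multiplicative.toAdd g).1.val
          * β ^ (Multiplicative.toAdd g).2.val) i = i).card = 24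
          ∨ (univ.filter fun i => (α ^ (Multiplicative.toAdd g).1.val
          * β ^ (Multiplicative.toAdd g).2.val) i = i).card = 38
          ∨ (univ.filter fun i => (α ^ (Multiplicative.toAdd g).1.val
          * β ^ (Multiplicative.toAdd g).2.val) i = i).card = 52
          ∨ (univ.filter fun i => (α ^ (Multiplicative.toAdd g).1.val
          * β ^ (Multiplicative.toAdd g).2.val) i = i).card = 66
          ∨ (univ.filter fun i => (α ^ (Multiplicative.toAdd g).1.val
          * β ^ (Multiplicative.toAdd g).2.val) i = i).card = 80) := by
    intro g hg
    obtain ⟨d, e, hg'⟩ := isSignedAut_pair 7 hA hB g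
    exact census7 hH hι hg' (pairPerm_pow_p 7 α β hα hβ hc g) (pairPerm_pow_p 7 α' β' hα' hβ' hc' g) (hne g hg)
  -- a free row
  have hN : ∀ r ∈ (insert (Multiplicative.ofAdd ((0 : ZMod 7), (1 : ZMod 7)))
        ((univ : Finset (ZMod 7)).image (fun t => Multiplicative.ofAdd ((1 : ZMod 7), t)))),
            (univ.filter fun x => (α ^ (Multiplicative.toAdd r).1.val
            * β ^ (Multiplicative.toAdd r).2.val) x = x).card ≤ 80 := by
    intro r hr
    have h := (hcensus r (lineRep_ne_one 7 hr)).2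
    omega
  obtain ⟨x₁, hx₁⟩ := rank2_exists_free 7 α β hα hβ hc 80 hN (by rw [hι]; norm_num)
  have h49 := rank2_regular_bound 7 hH hodd hA hB hα hα' hβ hβ' hc x₁ hx₁
  rw [hι] at h49
  refine ⟨h49, ?_⟩
  obtain ⟨hg1R, -, -, hg1, -, -⟩ := gens_reps 7
  obtain ⟨-, hm⟩ := rank2_card_fixed_mod_gen 7 α' β' hα' hβ' hc' hg1R
  have hcen := (hcensus _ hg1).1
  rw [pairPerm_genA] at hcen
  rw [pairPerm_genA] at hm
  omega

/-- **(2) a representative fixing a row outside `D`**, given `49·|D|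
    ≤ 668` and `|D| ≡ 3 (mod 7)` for the rows `D` fixed
by everything -/
lemma rank2_7_exists_moved (hH : IsHadamardMatrix H) (hι : Fintype.card ι = 668)
    (hA : IsSignedAut H α α' d₁ e₁) (hB : IsSignedAut H β β' d₂ e₂)
    (hα : α ^ 7 = 1) (hα' : α' ^ 7 = 1) (hβ : β ^ 7 = 1) (hβ' : β' ^ 7 = 1)
    (hc : Commute α β) (hc' : Commute α' β')
    (hne : ∀ g : Multiplicative (ZMod 7 × ZMod 7), g ≠ 1 → (α ^ (Multiplicative.toAdd g).1.val
        * β ^ (Multiplicative.toAdd g).2.val) ≠ 1)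
    (h49 : 7 ^ 2 * (univ.filter fun x => α x = x ∧ β x = x).card ≤ 668)
    (hmod : (univ.filter fun x => α x = x ∧ β x = x).card % 7 = 3) :
    ∃ rK ∈ (insert (Multiplicative.ofAdd ((0 : ZMod 7), (1 : ZMod 7)))
        ((univ : Finset (ZMod 7)).image (fun t => Multiplicative.ofAdd ((1 : ZMod 7), t)))), ∃ x₀ : ι,
            (α ^ (Multiplicative.toAdd rK).1.val * β ^ (Multiplicative.toAdd rK).2.val) x₀ = x₀ ∧ ¬ (α x₀ = x₀
            ∧ β x₀ = x₀) := by
  classical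
  haveI hp7 : Fact (Nat.Prime 7) := ⟨by norm_num⟩
  set fR : Multiplicative (ZMod 7 × ZMod 7)
      → ℕ := fun g => (univ.filter fun x => (α ^ (Multiplicative.toAdd g).1.val
      * β ^ (Multiplicative.toAdd g).2.val) x = x).card with hfR
  have hcensus : ∀ g : Multiplicative (ZMod 7 × ZMod 7), g ≠ 1 →
      (fR g = 24 ∨ fR g = 38 ∨ fR g = 52 ∨ fR g = 66 ∨ fR g = 80) := by
    intro g hg
    obtain ⟨d, e, hg'⟩ := isSignedAut_pair 7 hA hB g
    exact (census7 hH hι hg' (pairPerm_pow_p 7 α β hα hβ hc g) (pairPerm_pow_p 7 α' β' hα' hβ' hc' g) (hne g hg)).2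
  have hfR1 : fR 1 = 668 := by
    simp only [hfR, toAdd_one, Prod.fst_zero, Prod.snd_zero, ZMod.val_zero, pow_zero, mul_one,
      Equiv.Perm.one_apply]
    rw [Finset.filter_true_of_mem (fun _ _ => trivial), Finset.card_univ, hι]
  have hfRpow : ∀ g, g ≠ 1 → ∀ k, k < 7 - 1 → fR (g ^ (k + 1)) = fR g := by
    intro g hg k hk
    simp only [hfR]
    rw [pairPerm_pow 7 α β hα hβ hc g (k + 1),
      fixed_pow_eq 7 _ (pairPerm_pow_p 7 α β hα hβ hc g) (by omega) (by omega)]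
  have hdvdR : 7 ^ 2 ∣ ∑ g, fR g := sq_dvd_sum_card_fixed_pair 7 α β hα hβ hc
  have hsumR : ∑ g, fR g = 668 + (7 - 1) * ∑ r ∈ (insert (Multiplicative.ofAdd ((0 : ZMod 7), (1 : ZMod 7)))
        ((univ : Finset (ZMod 7)).image (fun t => Multiplicative.ofAdd ((1 : ZMod 7), t)))), fR r := by
    rw [← Finset.sum_erase_add _ _ (Finset.mem_univ (1 : Multiplicative (ZMod 7 × ZMod 7))), hfR1,
      sum_erase_one_eq_lines 7 fR hfRpow, add_comm]
  -- some representative has fR r ≠ |D|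
  have hexK : ∃ rK ∈ (insert (Multiplicative.ofAdd ((0 : ZMod 7), (1 : ZMod 7)))
        ((univ : Finset (ZMod 7)).image (fun t => Multiplicative.ofAdd ((1 : ZMod 7), t)))),
            fR rK ≠ (univ.filter fun x => α x = x ∧ β x = x).card := by
    by_contra hno
    have hall : ∀ r ∈ (insert (Multiplicative.ofAdd ((0 : ZMod 7), (1 : ZMod 7)))
        ((univ : Finset (ZMod 7)).image (fun t => Multiplicative.ofAdd ((1 : ZMod 7), t)))), fR r
            = (univ.filter fun x => α x = x ∧ β x = x).card := by
      intro r hr; by_contra h; exact hno ⟨r, hr, h⟩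
    have hW : ∑ r ∈ (insert (Multiplicative.ofAdd ((0 : ZMod 7), (1 : ZMod 7)))
        ((univ : Finset (ZMod 7)).image (fun t => Multiplicative.ofAdd ((1 : ZMod 7), t)))), fR r
            = (7 + 1) * (univ.filter fun x => α x = x ∧ β x = x).card := by
      rw [Finset.sum_congr rfl hall, Finset.sum_const, smul_eq_mul, card_lineReps 7]
    rw [hsumR, hW] at hdvdR
    norm_num at hdvdR h49
    omega
  obtain ⟨rK, hrK, hrKD⟩ := hexK
  have hDle := (rank2_card_fixed_mod_gen 7 α β hα hβ hc hrK).1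
  have hlt : (univ.filter fun x => α x = x ∧ β x = x).card < fR rK := lt_of_le_of_ne hDle (Ne.symm hrKD)
  have hpos : 0 < ((univ.filter fun x => (α ^ (Multiplicative.toAdd rK).1.val
      * β ^ (Multiplicative.toAdd rK).2.val) x = x) \ (univ.filter fun x => α x = x ∧ β x = x)).card := by
    have := Finset.card_le_card_sdiff_add_card (s := univ.filter fun x => (α ^ (Multiplicative.toAdd rK).1.val
        * β ^ (Multiplicative.toAdd rK).2.val) x = x)
      (t := univ.filter fun x => α x = x ∧ β x = x)
    simp only [hfR] at hlt
    omega
  obtain ⟨x₀, hx₀⟩ := Finset.card_pos.mp hpos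
  rw [Finset.mem_sdiff, Finset.mem_filter, Finset.mem_filter] at hx₀
  exact ⟨rK, hrK, x₀, hx₀.1.2, fun h => hx₀.2 ⟨Finset.mem_univ _, h⟩⟩

/-- the final arithmetic of the `C₇ × C₇` argument -/
lemma rank2_7_arith (Tc dD S : ℕ) (h1 : 7 * Tc ≤ 668) (h2 : Tc = dD + S) (h3 : 7 * 14 ≤ S) (h4 : 7 ^ 2 * dD ≤ 668)
    (h5 : dD % 7 = 3) : False := by
  omega

/-- **No `C₇ × C₇` of signed automorphisms of a Hadamard matrix of order 668.** -/
theorem no_hadamard668_elemAbelian_rank2_7 (hH : IsHadamardMatrix H)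
    (hι : Fintype.card ι = 668)
    (hA : IsSignedAut H α α' d₁ e₁) (hB : IsSignedAut H β β' d₂ e₂)
    (hα : α ^ 7 = 1) (hα' : α' ^ 7 = 1) (hβ : β ^ 7 = 1) (hβ' : β' ^ 7 = 1)
    (hc : Commute α β) (hc' : Commute α' β')
    (hind : ∀ a b : ℕ, a < 7 → b < 7 → α ^ a * β ^ b = 1 → a = 0 ∧ b = 0) : False := by
  classical
  haveI hp7 : Fact (Nat.Prime 7) := ⟨by norm_num⟩
  have hodd : Odd 7 := ⟨3, by norm_num⟩; have hcard : (Fintype.card ι : ℤ) ≠ 0 := by rw [hι]; norm_num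
  have hHt : IsHadamardMatrix Hᵀ := isHadamard_transpose hH hcard
  -- nontriviality of the row parts and of the column parts of every g ≠ 1
  have hne : ∀ g : Multiplicative (ZMod 7 × ZMod 7), g ≠ 1 → (α ^ (Multiplicative.toAdd g).1.val
      * β ^ (Multiplicative.toAdd g).2.val) ≠ 1 :=
    fun g hg => pairPerm_ne_one 7 α β hind hg
  have hne' : ∀ g : Multiplicative (ZMod 7 × ZMod 7), g ≠ 1 → (α' ^ (Multiplicative.toAdd g).1.val
      * β' ^ (Multiplicative.toAdd g).2.val) ≠ 1 := by
    intro g hg h1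
    have ht := isSignedAut_transpose (isSignedAut_mul (isSignedAut_pow hA (Multiplicative.toAdd g).1.val)
      (isSignedAut_pow hB (Multiplicative.toAdd g).2.val))
    rw [h1] at ht
    exact hne g hg (signedAut_snd_eq_one Hᵀ hHt hcard ht hodd (pairPerm_pow_p 7 α β hα hβ hc g))
  -- (1) columns and rows fixed by everything
  obtain ⟨h49D', hmodD'⟩ := rank2_7_fixedAll hH hι hA hB hα hα' hβ hβ' hc hc' hne
  obtain ⟨h49D, hmodD⟩ := rank2_7_fixedAll hHt hι (isSignedAut_transpose hA) (isSignedAut_transpose hB)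
    hα' hα hβ' hβ hc' hc hne'
  -- (2) a representative rK fixing a row x₀ that α or β moves
  obtain ⟨rK, hrK, x₀, hx₀K, hx₀D⟩ := rank2_7_exists_moved hH hι hA hB hα hα' hβ hβ' hc hc' hne h49D hmodD
  obtain ⟨hg1R, hh1R, -, hg1, hh1, -⟩ := gens_reps 7
  have hexh : ∃ h ∈ (insert (Multiplicative.ofAdd ((0 : ZMod 7), (1 : ZMod 7)))
        ((univ : Finset (ZMod 7)).image (fun t => Multiplicative.ofAdd ((1 : ZMod 7), t)))),
            (α ^ (Multiplicative.toAdd h).1.val * β ^ (Multiplicative.toAdd h).2.val) x₀ ≠ x₀ := by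
    by_cases hαx : α x₀ = x₀
    · refine ⟨_, hh1R, fun hβx => hx₀D ⟨hαx, ?_⟩⟩
      rw [pairPerm_genB] at hβx
      exact hβx
    · refine ⟨_, hg1R, fun hαx' => hαx ?_⟩
      rw [pairPerm_genA] at hαx'
      exact hαx'
  obtain ⟨h, hhR, hhx⟩ := hexh
  -- (3) the cycle bound and the count of T
  have hgline : rK ∈ (Finset.range (7 - 1)).image (fun k => rK ^ (k + 1)) :=
    Finset.mem_image.mpr ⟨0, Finset.mem_range.mpr (by norm_num), by rw [zero_add, pow_one]⟩
  have hT := rank2_cycle_bound 7 hH hodd hA hB hα hα' hβ hβ' hc hc' (lineRep_ne_one 7 hrK) (lineRep_ne_one 7 hhR)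
    hx₀K hhx hrK hgline
  rw [hι] at hT
  have hTcard := rank2_card_biUnion_fixed_gen 7 α' β' hα' hβ' hc' hrK
  have hRKcard : ((insert (Multiplicative.ofAdd ((0 : ZMod 7), (1 : ZMod 7)))
        ((univ : Finset (ZMod 7)).image (fun t => Multiplicative.ofAdd ((1 : ZMod 7),
            t)))).erase rK).card = 7 := by rw [Finset.card_erase_of_mem hrK, card_lineReps 7]
  have hS := card_mul_le_sum_sub ((insert (Multiplicative.ofAdd ((0 : ZMod 7), (1 : ZMod 7)))
        ((univ : Finset (ZMod 7)).image (fun t => Multiplicative.ofAdd ((1 : ZMod 7), t)))).erase rK)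
    (fun r => (univ.filter fun y => (α' ^ (Multiplicative.toAdd r).1.val
        * β' ^ (Multiplicative.toAdd r).2.val) y = y).card)
    ((univ.filter fun y => α' y = y ∧ β' y = y).card) 14 (by
      intro r hr
      obtain ⟨d, e, hr'⟩ := isSignedAut_pair 7 hA hB r
      have hcen := (census7 hH hι hr' (pairPerm_pow_p 7 α β hα hβ hc r) (pairPerm_pow_p 7 α' β' hα' hβ' hc' r)
        (hne r (lineRep_ne_one 7 (Finset.mem_erase.mp hr).2))).1
      norm_num at h49D'
      omega)
  rw [hRKcard] at hS
  exact rank2_7_arith _ _ _ hT hTcard hS h49D' hmodD'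

end seven

end Summit.Ventures.DiscreteObjects.Hadamard
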